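import Summits.Ventures.CertifiedArithmetic.Expansions.Orient3dExact
import Literature.ComputerArithmetic.Shewchuk1997.IncircleStageA
import Mathlib.Tactic.Linarith
import Mathlib.Tactic.Ring
import Mathlib.Tactic.NormNum

/-!
# INCIRCLE exactly, in weakly nonoverlapping expansion arithmetic

NEW WORK of this development (ENGINES group, unit `eng-quad-4`; HONEST FRAMING: shared numerical
engines serving client cells; rigour lives in the verifiers; every published number belongs to a
client cell's ledger, not to the engines group).  Not a published result, hence under
`Summits/Ventures/` with no citation tag of its own; the algorithm is the non-adaptive exact
in-circle test of Shewchuk's public-domain `predicates.c` (routine `incircleexact`, as we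
understand its structure), whose text we do not hold — the definition below is our transcription
of that STRUCTURE and is what the theorems are about; nothing is claimed about the C code itself.
Companion of `Orient3dExact.lean`, whose bookkeeping predicate `ExactW`, minor blocks and
three-minor sums it reuses.

THE SCHEME (`incircleExact`).  The in-circle determinant is the `4 × 4` determinant with rows
`(x, y, x² + y², 1)`; expanded along the column of ones it is
`|a|²·bcd − |b|²·cda + |c|²·dab − |d|²·abc` with the same six `xy`-minor blocks and four
three-minor sums `bcd = bc ⊞ cd ⊞ (−bd)`, `cda`, `dab`, `abc = ab ⊞ bc ⊞ (−ac)` as ORIENT3D's exact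
routine (`orient3dMinor3`, ≤ 12 components).  The lifted coordinate `|a|² = a₁² + a₂²` is not a
float, so each cofactor is formed as `(bcd ⊗ a₁) ⊗ a₁ ⊞ (bcd ⊗ a₂) ⊗ a₂` — two SCALE-EXPANSIONs
with zero elimination per coordinate (≤ 24, ≤ 48) and one FAST-EXPANSION-SUM (≤ 96),
`incircleCofactor`; the signs of `bdet`, `ddet` are carried by the second multipliers
(`(cda ⊗ b₁) ⊗ (−b₁) ⊞ (cda ⊗ b₂) ⊗ (−b₂)`; where exactly `predicates.c` places the sign we do not
assert — the value is the same).  Finally `deter = (adet ⊞ bdet) ⊞ (cdet ⊞ ddet)` (≤ 384 components)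
and the answer is the sign of its last component.

WHAT IS PROVED (`p ≥ 4`; `fl` any round-to-nearest into `F(p, emin)` with `RoundoffBelow 2` — e.g.
ties-to-even; `tp` a two-product error-free on `F(p, e₀)²`, `F(p, 2e₀) × F(p, e₀)` and
`F(p, 3e₀) × F(p, e₀)`; the eight coordinates in `F(p, e₀)` with `2e₀, 3e₀, 4e₀ ≥ emin`, i.e. no
product of four coordinates' worth of magnitude underflows):
* `incircleExact_spec` — `deter` is a NONEMPTY weakly nonoverlapping expansion of at most 384
  floats, all nonzero unless it is `⟨0⟩`, whose sum is `incircleDet a b c d` of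
  `IncircleStageA.lean` EXACTLY (the `4 × 4` cofactor form equals the translated lifted `3 × 3`
  determinant identically — translation invariance of the lifted determinant, here just `ring`).
* `incircleExact_sign` — the last component decides: `det > 0 ↔ last > 0`, `det < 0 ↔ last < 0`,
  `det = 0 ↔ deter = ⟨0⟩`.
* Instances: `incircleExact_fma_sign` (FMA two-product) and the IEEE headline
  `incircleExactRNE_correct` (round-to-nearest-even + FMA two-product; binary64: all coordinates
  multiples of `2^−268`).
New tool: `exactW_scale_coarse`, SCALE-EXPANSION with zero elimination KEEPS a coarse format
(`F(p, g)` components times an `F(p, e₀)` multiplier land in `F(p, g + e₀)`,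
`scaleExpansionZeroElim_coarse` of `IncircleStageBExpansion.lean`), which is what lets the second
scaling see exact two-products and lets the cofactor halves be summed on a common grid.

HONEST SCOPE.  (1) This is the STANDALONE exact routine, not stage D of the adaptive
`incircleadapt`; both decide the sign of the same determinant exactly.  (2) Model conventions as in
`Orient2d.lean` / `Orient3dExact.lean` (zero elimination as a post-pass, merge order on ties,
TWO-TWO-DIFF as EXPANSION-SUM, no overflow model, `F(p, e₀)` with `4e₀ ≥ emin` excludes the
gradual-underflow range).  (3) The 384-component bound is the structural one
(`12 → 24 → 48`, `48 + 48`, `96 + 96`, `192 + 192`); no claim that it is attained.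

No separate numerical evidence was gathered beyond a check of the cofactor identity on random
rationals (it is proved by `ring` below): the theorems compose landed, individually evidenced
lemmas.

Reference for the algorithm: J. R. Shewchuk, Discrete Comput. Geom. 18 (1997) 305–363, §4 and
`predicates.c` (`incircleexact`) [Shewchuk1997].
-/

namespace Summit.Ventures.CertifiedArithmetic.Expansions

open Literature.ComputerArithmetic.JeannerodRump2018
open Literature.ComputerArithmetic.BoldoJeannerodMelquiondMuller2023 hiding twoSum twoSum_fst
  isFloat_twoSum
open Literature.ComputerArithmetic.Shewchuk1997

variable {p : ℕ} {emin : ℤ} {fl : ℚ → ℚ}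

/-! ## SCALE-EXPANSION keeps a coarse format -/

/-- SCALE-EXPANSION with zero elimination of an expansion on the coarse format `F(p, g)` by a
multiplier `z ∈ F(p, e₀)`, `g + e₀ ≥ emin` (no product underflows), error-free two-products on
`F(p, g) × F(p, e₀)`: class W, floats of `F(p, emin)` ON THE COARSE FORMAT `F(p, g + e₀)`, sum
`v·z`, at most `2n` components (Theorem 3 with zero elimination and
`scaleExpansionZeroElim_coarse`). -/
theorem exactW_scale_coarse (hp : 1 ≤ p) (hfl : IsRoundNearest p emin fl)
    (hfl2 : RoundoffBelow 2 fl) {g e₀ : ℤ} (h : emin ≤ g + e₀) {tp : ℚ → ℚ → ℚ × ℚ}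
    (htp : ∀ x y, IsFloat p g x → IsFloat p e₀ y → ExactTwoProd p emin fl tp x y)
    {n : ℕ} {v : ℚ} {m : List ℚ} (hm : ExactW p emin g n v m) {z : ℚ} (hz : IsFloat p e₀ z)
    {n' : ℕ} (hn : 2 * n ≤ n') (hn1 : 1 ≤ n') {w : ℚ} (hw : v * z = w) :
    ExactW p emin (g + e₀) n' w (scaleExpansionZeroElim tp fl m z) := by
  obtain ⟨Mb, kb, hMb, hkb, hrep⟩ := hz
  have hz' : IsFloat p e₀ z := ⟨Mb, kb, hMb, hkb, hrep⟩
  have heU : ∀ x ∈ m, IsFloat p (emin - kb) x := fun x hx =>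
    isFloat_of_emin_le (by omega) (hm.coarse x hx)
  have htpS : ∀ x ∈ m, (tp x z).1 = fl (x * z) ∧ (tp x z).1 + (tp x z).2 = x * z := fun x hx =>
    let h := htp x z (hm.coarse x hx) hz'
    ⟨h.1, h.2.1⟩
  obtain ⟨hW, hS, hF, -, -, hL⟩ :=
    scaleExpansionZeroElim_spec hp hfl hfl2 hrep hMb hm.float heU hm.weak htpS
  refine ⟨hW, hF, scaleExpansionZeroElim_coarse hp hfl h hm.coarse hz' htpS hF,
    by rw [hS, hm.sum_eq, hw], le_trans hL (max_le ?_ hn1)⟩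
  have h₁ := hm.length_le
  omega

/-! ## The lifted cofactor -/

/-- A cofactor of the lifted determinant: `(m ⊗ x) ⊗ s ⊞ (m ⊗ y) ⊗ t` — for `adet` take
`(x, y, s, t) = (a₁, a₂, a₁, a₂)` (value `bcd·|a|²`), for `bdet` take `(b₁, b₂, −b₁, −b₂)` (value
`−cda·|b|²`); SCALE-EXPANSION with zero elimination four times, FAST-EXPANSION-SUM once. -/
def incircleCofactor (tp : ℚ → ℚ → ℚ × ℚ) (fl : ℚ → ℚ) (m : List ℚ) (x y s t : ℚ) : List ℚ :=
  fastExpansionSumZeroElim fl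
    (scaleExpansionZeroElim tp fl (scaleExpansionZeroElim tp fl m x) s)
    (scaleExpansionZeroElim tp fl (scaleExpansionZeroElim tp fl m y) t)

/-- A three-minor sum of at most twelve components on `F(p, 2e₀)` with value `v`, lifted by
multipliers `x, y, s, t ∈ F(p, e₀)` (`3e₀, 4e₀ ≥ emin`, error-free two-products on
`F(p, 2e₀) × F(p, e₀)` and `F(p, 3e₀) × F(p, e₀)`, `p ≥ 4`): at most 96 components on `F(p, 4e₀)`
of class W, exact value `v·(x·s + y·t)`. -/
theorem exactW_cofactor (hp : 4 ≤ p) (hfl : IsRoundNearest p emin fl) (hfl2 : RoundoffBelow 2 fl)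
    {e₀ : ℤ} (h3 : emin ≤ e₀ + e₀ + e₀) (h4 : emin ≤ e₀ + e₀ + e₀ + e₀) {tp : ℚ → ℚ → ℚ × ℚ}
    (htp' : ∀ x y, IsFloat p (e₀ + e₀) x → IsFloat p e₀ y → ExactTwoProd p emin fl tp x y)
    (htp'' : ∀ x y, IsFloat p (e₀ + e₀ + e₀) x → IsFloat p e₀ y → ExactTwoProd p emin fl tp x y)
    {v : ℚ} {m : List ℚ} (hm : ExactW p emin (e₀ + e₀) 12 v m) {x y s t : ℚ}
    (hx : IsFloat p e₀ x) (hy : IsFloat p e₀ y) (hs : IsFloat p e₀ s) (ht : IsFloat p e₀ t) :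
    ExactW p emin (e₀ + e₀ + e₀ + e₀) 96 (v * (x * s + y * t))
      (incircleCofactor tp fl m x y s t) := by
  have hp1 : 1 ≤ p := le_trans (by norm_num) hp
  have X := exactW_scale_coarse hp1 hfl hfl2 h3 htp' hm hx (n' := 24) (by norm_num) (by norm_num)
    rfl
  have Y := exactW_scale_coarse hp1 hfl hfl2 h3 htp' hm hy (n' := 24) (by norm_num) (by norm_num)
    rfl
  have XS := exactW_scale_coarse hp1 hfl hfl2 h4 htp'' X hs (n' := 48) (by norm_num)
    (by norm_num) rfl
  have YT := exactW_scale_coarse hp1 hfl hfl2 h4 htp'' Y ht (n' := 48) (by norm_num)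
    (by norm_num) rfl
  exact exactW_fesze hp hfl hfl2 h4 XS YT (n := 96) (by norm_num) (by norm_num) (by ring)

/-! ## The scheme -/

/-- **INCIRCLE EXACTLY** (the structure of `predicates.c`'s `incircleexact`) over a two-product
`tp` and a rounding `fl`, on the eight coordinates of `a, b, c, d`: the zero-eliminated expansion
`deter = (adet ⊞ bdet) ⊞ (cdet ⊞ ddet)` with `adet = (bcd ⊗ a₁) ⊗ a₁ ⊞ (bcd ⊗ a₂) ⊗ a₂`,
`bdet = (cda ⊗ b₁) ⊗ (−b₁) ⊞ (cda ⊗ b₂) ⊗ (−b₂)`, `cdet = (dab ⊗ c₁) ⊗ c₁ ⊞ (dab ⊗ c₂) ⊗ c₂`,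
`ddet = (abc ⊗ d₁) ⊗ (−d₁) ⊞ (abc ⊗ d₂) ⊗ (−d₂)` over the three-minor sums of `Orient3dExact.lean`
(the C code returns `deter[deterlen − 1]`). -/
def incircleExact (tp : ℚ → ℚ → ℚ × ℚ) (fl : ℚ → ℚ) (a₁ a₂ b₁ b₂ c₁ c₂ d₁ d₂ : ℚ) : List ℚ :=
  fastExpansionSumZeroElim fl
    (fastExpansionSumZeroElim fl
      (incircleCofactor tp fl
        (orient3dMinor3 fl (twoTwoProdDiff tp fl b₁ c₂ c₁ b₂) (twoTwoProdDiff tp fl c₁ d₂ d₁ c₂)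
          (negComponents (twoTwoProdDiff tp fl b₁ d₂ d₁ b₂))) a₁ a₂ a₁ a₂)
      (incircleCofactor tp fl
        (orient3dMinor3 fl (twoTwoProdDiff tp fl c₁ d₂ d₁ c₂) (twoTwoProdDiff tp fl d₁ a₂ a₁ d₂)
          (twoTwoProdDiff tp fl a₁ c₂ c₁ a₂)) b₁ b₂ (-b₁) (-b₂)))
    (fastExpansionSumZeroElim fl
      (incircleCofactor tp fl
        (orient3dMinor3 fl (twoTwoProdDiff tp fl d₁ a₂ a₁ d₂) (twoTwoProdDiff tp fl a₁ b₂ b₁ a₂)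
          (twoTwoProdDiff tp fl b₁ d₂ d₁ b₂)) c₁ c₂ c₁ c₂)
      (incircleCofactor tp fl
        (orient3dMinor3 fl (twoTwoProdDiff tp fl a₁ b₂ b₁ a₂) (twoTwoProdDiff tp fl b₁ c₂ c₁ b₂)
          (negComponents (twoTwoProdDiff tp fl a₁ c₂ c₁ a₂))) d₁ d₂ (-d₁) (-d₂)))

/-- **THEOREM (INCIRCLE's exact routine computes an exact W-expansion of the determinant).**  Let
`p ≥ 4`, `fl` a round-to-nearest whose roundoff lies 2-below its result (e.g. ties-to-even), the
eight coordinates in `F(p, e₀)` with `2e₀, 3e₀, 4e₀ ≥ emin`, and `tp` a two-product error-free on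
`F(p, e₀)²`, `F(p, 2e₀) × F(p, e₀)` and `F(p, 3e₀) × F(p, e₀)`.  Then `incircleExact` is a NONEMPTY
weakly nonoverlapping expansion of at most 384 floats, all nonzero unless it is `⟨0⟩`, whose sum
is the in-circle determinant `incircleDet` EXACTLY. -/
theorem incircleExact_spec (hp : 4 ≤ p) (hfl : IsRoundNearest p emin fl) (hfl2 : RoundoffBelow 2 fl)
    {e₀ : ℤ} (h2 : emin ≤ e₀ + e₀) (h3 : emin ≤ e₀ + e₀ + e₀) (h4 : emin ≤ e₀ + e₀ + e₀ + e₀)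
    {tp : ℚ → ℚ → ℚ × ℚ}
    (htp : ∀ x y, IsFloat p e₀ x → IsFloat p e₀ y → ExactTwoProd p emin fl tp x y)
    (htp' : ∀ x y, IsFloat p (e₀ + e₀) x → IsFloat p e₀ y → ExactTwoProd p emin fl tp x y)
    (htp'' : ∀ x y, IsFloat p (e₀ + e₀ + e₀) x → IsFloat p e₀ y → ExactTwoProd p emin fl tp x y)
    {a₁ a₂ b₁ b₂ c₁ c₂ d₁ d₂ : ℚ} (ha₁ : IsFloat p e₀ a₁) (ha₂ : IsFloat p e₀ a₂)
    (hb₁ : IsFloat p e₀ b₁) (hb₂ : IsFloat p e₀ b₂) (hc₁ : IsFloat p e₀ c₁)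
    (hc₂ : IsFloat p e₀ c₂) (hd₁ : IsFloat p e₀ d₁) (hd₂ : IsFloat p e₀ d₂) :
    IsWeakExpansion (incircleExact tp fl a₁ a₂ b₁ b₂ c₁ c₂ d₁ d₂) ∧
      (incircleExact tp fl a₁ a₂ b₁ b₂ c₁ c₂ d₁ d₂).sum = incircleDet a₁ a₂ b₁ b₂ c₁ c₂ d₁ d₂ ∧
      (∀ x ∈ incircleExact tp fl a₁ a₂ b₁ b₂ c₁ c₂ d₁ d₂, IsFloat p emin x) ∧
      incircleExact tp fl a₁ a₂ b₁ b₂ c₁ c₂ d₁ d₂ ≠ [] ∧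
      ((∀ x ∈ incircleExact tp fl a₁ a₂ b₁ b₂ c₁ c₂ d₁ d₂, x ≠ 0) ∨
        incircleExact tp fl a₁ a₂ b₁ b₂ c₁ c₂ d₁ d₂ = [0]) ∧
      (incircleExact tp fl a₁ a₂ b₁ b₂ c₁ c₂ d₁ d₂).length ≤ 384 := by
  have hp1 : 1 ≤ p := le_trans (by norm_num) hp
  have M : ∀ {a b c d : ℚ}, IsFloat p e₀ a → IsFloat p e₀ b → IsFloat p e₀ c → IsFloat p e₀ d →
      ExactW p emin (e₀ + e₀) 4 (a * b - c * d) (twoTwoProdDiff tp fl a b c d) :=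
    fun ha hb hc hd => exactW_block hp1 hfl hfl2 h2 htp ha hb hc hd
  have AB := M ha₁ hb₂ hb₁ ha₂
  have BC := M hb₁ hc₂ hc₁ hb₂
  have CD := M hc₁ hd₂ hd₁ hc₂
  have DA := M hd₁ ha₂ ha₁ hd₂
  have AC := M ha₁ hc₂ hc₁ ha₂
  have BD := M hb₁ hd₂ hd₁ hb₂
  have BCD := exactW_minor3 (fl := fl) hp hfl hfl2 h2 BC CD (exactW_neg BD)
  have CDA := exactW_minor3 (fl := fl) hp hfl hfl2 h2 CD DA AC
  have DAB := exactW_minor3 (fl := fl) hp hfl hfl2 h2 DA AB BD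
  have ABC := exactW_minor3 (fl := fl) hp hfl hfl2 h2 AB BC (exactW_neg AC)
  have Ad := exactW_cofactor hp hfl hfl2 h3 h4 htp' htp'' BCD ha₁ ha₂ ha₁ ha₂
  have Bd := exactW_cofactor hp hfl hfl2 h3 h4 htp' htp'' CDA hb₁ hb₂ hb₁.neg hb₂.neg
  have Cd := exactW_cofactor hp hfl hfl2 h3 h4 htp' htp'' DAB hc₁ hc₂ hc₁ hc₂
  have Dd := exactW_cofactor hp hfl hfl2 h3 h4 htp' htp'' ABC hd₁ hd₂ hd₁.neg hd₂.neg
  have ABd := exactW_fesze hp hfl hfl2 h4 Ad Bd (n := 192) (by norm_num) (by norm_num) rfl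
  have CDd := exactW_fesze hp hfl hfl2 h4 Cd Dd (n := 192) (by norm_num) (by norm_num) rfl
  have D := exactW_fesze hp hfl hfl2 h4 ABd CDd (n := 384) (by norm_num) (by norm_num) rfl
  obtain ⟨-, -, -, N, Z, -⟩ :=
    fastExpansionSumZeroElim_spec hp hfl hfl2 ABd.float ABd.weak CDd.float CDd.weak
  refine ⟨D.weak, ?_, D.float, N, Z, D.length_le⟩
  unfold incircleExact
  rw [D.sum_eq, incircleDet]
  ring

/-- **The sign of the in-circle determinant from the exact expansion**: the LAST component of
`incircleExact` decides `det > 0`, `det < 0`, and `det = 0 ↔ incircleExact = ⟨0⟩`. -/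
theorem incircleExact_sign (hp : 4 ≤ p) (hfl : IsRoundNearest p emin fl) (hfl2 : RoundoffBelow 2 fl)
    {e₀ : ℤ} (h2 : emin ≤ e₀ + e₀) (h3 : emin ≤ e₀ + e₀ + e₀) (h4 : emin ≤ e₀ + e₀ + e₀ + e₀)
    {tp : ℚ → ℚ → ℚ × ℚ}
    (htp : ∀ x y, IsFloat p e₀ x → IsFloat p e₀ y → ExactTwoProd p emin fl tp x y)
    (htp' : ∀ x y, IsFloat p (e₀ + e₀) x → IsFloat p e₀ y → ExactTwoProd p emin fl tp x y)
    (htp'' : ∀ x y, IsFloat p (e₀ + e₀ + e₀) x → IsFloat p e₀ y → ExactTwoProd p emin fl tp x y)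
    {a₁ a₂ b₁ b₂ c₁ c₂ d₁ d₂ : ℚ} (ha₁ : IsFloat p e₀ a₁) (ha₂ : IsFloat p e₀ a₂)
    (hb₁ : IsFloat p e₀ b₁) (hb₂ : IsFloat p e₀ b₂) (hc₁ : IsFloat p e₀ c₁)
    (hc₂ : IsFloat p e₀ c₂) (hd₁ : IsFloat p e₀ d₁) (hd₂ : IsFloat p e₀ d₂) :
    ∃ hD : incircleExact tp fl a₁ a₂ b₁ b₂ c₁ c₂ d₁ d₂ ≠ [],
      (0 < incircleDet a₁ a₂ b₁ b₂ c₁ c₂ d₁ d₂ ↔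
          0 < (incircleExact tp fl a₁ a₂ b₁ b₂ c₁ c₂ d₁ d₂).getLast hD) ∧
        (incircleDet a₁ a₂ b₁ b₂ c₁ c₂ d₁ d₂ < 0 ↔
          (incircleExact tp fl a₁ a₂ b₁ b₂ c₁ c₂ d₁ d₂).getLast hD < 0) ∧
        (incircleDet a₁ a₂ b₁ b₂ c₁ c₂ d₁ d₂ = 0 ↔
          incircleExact tp fl a₁ a₂ b₁ b₂ c₁ c₂ d₁ d₂ = [0]) := by
  obtain ⟨hW, hS, hF, hne, hZ, -⟩ := incircleExact_spec hp hfl hfl2 h2 h3 h4 htp htp' htp''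
    ha₁ ha₂ hb₁ hb₂ hc₁ hc₂ hd₁ hd₂
  refine ⟨hne, ?_⟩
  rw [← hS]
  rcases hZ with hnz | h0
  · obtain ⟨s₁, s₂, s₃⟩ :=
      sign_sum_of_getLast_ne_zero hF hW.isExpansion hne (hnz _ (List.getLast_mem hne))
    refine ⟨s₁, s₂, ⟨fun h => absurd h s₃, fun h => ?_⟩⟩
    exfalso
    rw [h] at hnz
    exact hnz 0 (List.mem_singleton_self 0) rfl
  · have key : ∀ (L : List ℚ) (h : L ≠ []), L = [0] → L.getLast h = 0 ∧ L.sum = 0 := by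
      rintro L h rfl; exact ⟨rfl, by simp⟩
    obtain ⟨hl, hs0⟩ := key _ hne h0
    rw [hl, hs0]
    exact ⟨Iff.rfl, Iff.rfl, ⟨fun _ => h0, fun _ => rfl⟩⟩

/-! ## Instances: the FMA two-product; IEEE round-to-nearest-even -/

/-- **With the FMA two-product** (`2Prod_FMA`, any `RoundoffBelow 2` round-to-nearest, `p ≥ 4`):
the sign test is exact for coordinates in `F(p, e₀)`, `2e₀, 3e₀, 4e₀ ≥ emin`. -/
theorem incircleExact_fma_sign (hp : 4 ≤ p) (hfl : IsRoundNearest p emin fl)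
    (hfl2 : RoundoffBelow 2 fl) {e₀ : ℤ} (h2 : emin ≤ e₀ + e₀) (h3 : emin ≤ e₀ + e₀ + e₀)
    (h4 : emin ≤ e₀ + e₀ + e₀ + e₀) {a₁ a₂ b₁ b₂ c₁ c₂ d₁ d₂ : ℚ} (ha₁ : IsFloat p e₀ a₁)
    (ha₂ : IsFloat p e₀ a₂) (hb₁ : IsFloat p e₀ b₁) (hb₂ : IsFloat p e₀ b₂)
    (hc₁ : IsFloat p e₀ c₁) (hc₂ : IsFloat p e₀ c₂) (hd₁ : IsFloat p e₀ d₁)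
    (hd₂ : IsFloat p e₀ d₂) :
    ∃ hD : incircleExact (twoProdFMA fl) fl a₁ a₂ b₁ b₂ c₁ c₂ d₁ d₂ ≠ [],
      (0 < incircleDet a₁ a₂ b₁ b₂ c₁ c₂ d₁ d₂ ↔
          0 < (incircleExact (twoProdFMA fl) fl a₁ a₂ b₁ b₂ c₁ c₂ d₁ d₂).getLast hD) ∧
        (incircleDet a₁ a₂ b₁ b₂ c₁ c₂ d₁ d₂ < 0 ↔
          (incircleExact (twoProdFMA fl) fl a₁ a₂ b₁ b₂ c₁ c₂ d₁ d₂).getLast hD < 0) ∧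
        (incircleDet a₁ a₂ b₁ b₂ c₁ c₂ d₁ d₂ = 0 ↔
          incircleExact (twoProdFMA fl) fl a₁ a₂ b₁ b₂ c₁ c₂ d₁ d₂ = [0]) :=
  have hp1 : 1 ≤ p := le_trans (by norm_num) hp
  incircleExact_sign hp hfl hfl2 h2 h3 h4
    (fun _ _ hx hy => exactTwoProd_twoProdFMA₂ hp1 hfl h2 hx hy)
    (fun _ _ hx hy => exactTwoProd_twoProdFMA₂ hp1 hfl h3 hx hy)
    (fun _ _ hx hy => exactTwoProd_twoProdFMA₂ hp1 hfl h4 hx hy)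
    ha₁ ha₂ hb₁ hb₂ hc₁ hc₂ hd₁ hd₂

/-- INCIRCLE's exact routine as run on a round-to-nearest-even machine with the FMA two-product,
precision `p`, underflow threshold `emin`. -/
def incircleExactRNE (p : ℕ) (emin : ℤ) (a₁ a₂ b₁ b₂ c₁ c₂ d₁ d₂ : ℚ) : List ℚ :=
  incircleExact (twoProdFMA (roundTiesEven p emin)) (roundTiesEven p emin) a₁ a₂ b₁ b₂ c₁ c₂ d₁ d₂

/-- **INCIRCLE's exact routine IS CORRECT ON AN IEEE MACHINE** (round-to-nearest-even, FMA
two-product, `p ≥ 4`): for coordinates in `F(p, e₀)` with `emin ≤ 2e₀, 3e₀, 4e₀` (binary64,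
`p = 53`, `emin = −1074`: all eight coordinates multiples of `2^−268`), the computed expansion is
a weakly nonoverlapping expansion of floats with `Σ = incircleDet` exactly, and its last component
has the sign of the determinant, with `det = 0 ↔ ⟨0⟩`. -/
theorem incircleExactRNE_correct (hp : 4 ≤ p) {e₀ : ℤ} (h2 : emin ≤ e₀ + e₀)
    (h3 : emin ≤ e₀ + e₀ + e₀) (h4 : emin ≤ e₀ + e₀ + e₀ + e₀) {a₁ a₂ b₁ b₂ c₁ c₂ d₁ d₂ : ℚ}
    (ha₁ : IsFloat p e₀ a₁) (ha₂ : IsFloat p e₀ a₂) (hb₁ : IsFloat p e₀ b₁)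
    (hb₂ : IsFloat p e₀ b₂) (hc₁ : IsFloat p e₀ c₁) (hc₂ : IsFloat p e₀ c₂)
    (hd₁ : IsFloat p e₀ d₁) (hd₂ : IsFloat p e₀ d₂) :
    IsWeakExpansion (incircleExactRNE p emin a₁ a₂ b₁ b₂ c₁ c₂ d₁ d₂) ∧
      (incircleExactRNE p emin a₁ a₂ b₁ b₂ c₁ c₂ d₁ d₂).sum = incircleDet a₁ a₂ b₁ b₂ c₁ c₂ d₁ d₂ ∧
      (∀ x ∈ incircleExactRNE p emin a₁ a₂ b₁ b₂ c₁ c₂ d₁ d₂, IsFloat p emin x) ∧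
      ∃ hD : incircleExactRNE p emin a₁ a₂ b₁ b₂ c₁ c₂ d₁ d₂ ≠ [],
        (0 < incircleDet a₁ a₂ b₁ b₂ c₁ c₂ d₁ d₂ ↔
            0 < (incircleExactRNE p emin a₁ a₂ b₁ b₂ c₁ c₂ d₁ d₂).getLast hD) ∧
          (incircleDet a₁ a₂ b₁ b₂ c₁ c₂ d₁ d₂ < 0 ↔
            (incircleExactRNE p emin a₁ a₂ b₁ b₂ c₁ c₂ d₁ d₂).getLast hD < 0) ∧
          (incircleDet a₁ a₂ b₁ b₂ c₁ c₂ d₁ d₂ = 0 ↔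
            incircleExactRNE p emin a₁ a₂ b₁ b₂ c₁ c₂ d₁ d₂ = [0]) := by
  have hp1 : 1 ≤ p := le_trans (by norm_num) hp
  have hfl : IsRoundNearest p emin (roundTiesEven p emin) := isRoundNearest_roundTiesEven hp1
  have hfl2 : RoundoffBelow 2 (roundTiesEven p emin) := roundoffBelow_two_roundTiesEven p emin
  have htp : ∀ x y, IsFloat p e₀ x → IsFloat p e₀ y →
      ExactTwoProd p emin (roundTiesEven p emin) (twoProdFMA (roundTiesEven p emin)) x y :=
    fun x y hx hy => exactTwoProd_twoProdFMA₂ hp1 hfl h2 hx hy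
  have htp' : ∀ x y, IsFloat p (e₀ + e₀) x → IsFloat p e₀ y →
      ExactTwoProd p emin (roundTiesEven p emin) (twoProdFMA (roundTiesEven p emin)) x y :=
    fun x y hx hy => exactTwoProd_twoProdFMA₂ hp1 hfl h3 hx hy
  have htp'' : ∀ x y, IsFloat p (e₀ + e₀ + e₀) x → IsFloat p e₀ y →
      ExactTwoProd p emin (roundTiesEven p emin) (twoProdFMA (roundTiesEven p emin)) x y :=
    fun x y hx hy => exactTwoProd_twoProdFMA₂ hp1 hfl h4 hx hy
  obtain ⟨hW, hS, hF, -, -, -⟩ := incircleExact_spec hp hfl hfl2 h2 h3 h4 htp htp' htp''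
    ha₁ ha₂ hb₁ hb₂ hc₁ hc₂ hd₁ hd₂
  exact ⟨hW, hS, hF, incircleExact_sign hp hfl hfl2 h2 h3 h4 htp htp' htp''
    ha₁ ha₂ hb₁ hb₂ hc₁ hc₂ hd₁ hd₂⟩

end Summit.Ventures.CertifiedArithmetic.Expansions
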